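import Summits.Ventures.LatticeQCDFlow.Exactness.AcceptanceFromMeanEnergyViolationSharp
import Summits.Ventures.LatticeQCDFlow.Exactness.Phi4HMCEnergyViolationIntegrable
import Summits.Ventures.LatticeQCDFlow.Scaling.SwapAcceptanceMonotone
import Summits.Ventures.LatticeQCDFlow.Scaling.SwapLogRatioSumRule
import HarnessLib

/-!
HONEST FRAMING: exact (Metropolis-corrected) sampling algorithms for lattice gauge theory; figures
of merit are autocorrelation/cost numbers at stated couplings and volumes; no continuum-physics
claim.

# AcceptanceFromMeanEnergyViolationSharpSwap — THE EXTREMAL ACCEPTANCE FLOOR FOR THE REPLICA-EXCHANGE SWAP AND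
# FOR HMC: `⟨acc⟩ ≥ 1 − (cosh a − 1 + ⟨ΔS⟩)/(a + sinh a)` FOR EVERY `a > 0`; IN lean-2's VOCABULARY
# `swapAcc X μ s t ≥ 1 − (cosh a − 1 + (t−s)(ψ′(t) − ψ′(s)))/(a + sinh a)`; THE STIFF REGIME; AND THE CONVERSE:
# PAIRS ACCEPTING `≤ α` HAVE `⟨ΔS⟩ ≥ (1−α)log((2−α)/α)`, SO A FLAT-`α` LADDER HAS `K² ≤ span·(ψ′(c_K) − ψ′(c_0))/m_α`
# (row 22 `su3-ptbc`, GEN-10, ours)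

Venture `LatticeQCDFlow` (cell pub-lqcd), topic `Exactness`; FANOUT row 22 (`su3-ptbc`, PTBC comparator arm E4).
NEW WORK of the cell: instances and corollaries of this seat's `AcceptanceFromMeanEnergyViolationSharp`
(`involutive_acceptance_ge_cosh`), assembled with row 22's swap setting (`PTBCSwapMonitor`, `PTBCSwapSignRule`),
lean-2's bounded exponential family (`SwapAcceptanceLaw.swapAcc`, `SwapAcceptanceMonotone.integral_prod_tilted_eq_weighted`),
row 22's `SwapLogRatioMoments` / `SwapLogRatioSumRule` (`⟨ΔS⟩ = (t−s)(ψ′(t) − ψ′(s))`, the ladder sum rules) and row 2's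
lattice HMC (`Phi4HMCFluctuationRelation`, `Phi4HMCEnergyViolationIntegrable`).  Nothing is cited as a fact; no numerics.

## What is proved

* §1 THE STIFF REGIME (general involutive framework; `m = ⟨ΔH⟩`): `one_sub_coshPencil_self` (member `a = m`),
  **`involutive_acceptance_ge_stiff`** (`m > 0 ⇒ ((1 − e^{−m})/(m + sinh m))·Z ≤ A`, `∼ 2e^{−m}Z`, four times the
  Bretagnolle–Huber floor), `exp_neg_le_stiffFloor` (`m ≥ 2 ⇒ m + 1 ≤ cosh m` form),
  **`involutive_acceptance_ge_exp_neg_mean`** (`m ≥ 2 ⇒ e^{−m}·Z ≤ A`).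
* §2 THE PTBC SWAP (two replica slots with measurable actions `S₁, S₂` over an s-finite `vol`, joint weight
  `e^{−E}`, `E = pairEnergy S₁ S₂`, swap energy `ΔS = swapDelta S₁ S₂`, `ΔS e^{−E} ∈ L¹`):
  **`swap_acceptance_ge_cosh`** (weighted form) and **`swap_acceptance_ge_cosh_boltzmann`** — under the joint
  Boltzmann law `π`, `1 − (cosh a − 1 + ∫ ΔS dπ)/(a + sinh a) ≤ ∫ min(1, e^{−ΔS}) dπ` for every `a > 0`.
* §3 THE LINEAR TEMPERING FAMILY (`μ_u = μ.tilted(uX)`, `ψ = cgf X μ`): **`swapAcc_ge_coshPencil`** — for every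
  `s, t`, `a > 0`: `1 − (cosh a − 1 + (t − s)(ψ′(t) − ψ′(s)))/(a + sinh a) ≤ swapAcc X μ s t`.
* §4 ROW 2's LATTICE HMC (coercive action, every step size and trajectory length):
  **`hmc_acceptance_ge_cosh`**, `hmc_acceptance_ge_cosh_phi4`.
* §5 THE CONVERSE READING: **`meanSwap_ge_of_swapAcc_le`** — a pair accepting at most `α ∈ (0,1)` has
  `⟨ΔS⟩ ≥ (1 − α)·log((2 − α)/α)` (member `tanh(a/2) = 1 − α`; `α = 1/5`: `⟨ΔS⟩ ≥ (4/5)log 9`), and with GEN-9's sum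
  rule **`flatLadder_sq_count_le`** — a strictly increasing ladder all of whose adjacent pairs accept at most `α` has
  `(1 − α)log((2−α)/α)·K² ≤ (c_K − c_0)(ψ′(c_K) − ψ′(c_0))`: a MODEL-FREE CEILING on the number of replicas of a
  flat-acceptance ladder in terms of the span and the drop of the mean tempered statistic; and, because the pencil
  is AFFINE in the mean, **`uniformLadder_sum_swapAcc_ge`** — a uniform ladder's AVERAGE pair acceptance is at least
  the pencil (so the two-state curve) at the average mean `span·drop/K²`: `K ≥ √(span·drop/m_α)` uniform replicas
  GUARANTEE average acceptance `≥ α`, whatever the action.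

Reading for CARD-su3-ptbc §3 (value-free): per pair the measured acceptance must exceed
`1 − min_{a>0}(cosh a − 1 + mean dS)/(a + sinh a)` up to statistics (report-only column of
`code/swap_moment_report.py`); no bundle byte is touched.  NOT CLAIMED: any run value; a ceiling from `⟨ΔS⟩`.
-/

noncomputable section

namespace Summit.Ventures.LatticeQCDFlow.Exactness

open Real MeasureTheory Filter Set

/-! ## §1 The stiff regime -/

section Stiff

variable {X : Type*} [MeasurableSpace X] {μ : Measure X}

/-- The member `a = m` of the pencil: `1 − (cosh m − 1 + m)/(m + sinh m) = (1 − e^{−m})/(m + sinh m)`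
(`cosh m − sinh m = e^{−m}`), for `m > 0`. [ours] -/
theorem one_sub_coshPencil_self {m : ℝ} (hm : 0 < m) :
    1 - (Real.cosh m - 1 + m) / (m + Real.sinh m) = (1 - Real.exp (-m)) / (m + Real.sinh m) := by
  have hc : 0 < m + Real.sinh m := add_pos hm (Real.sinh_pos_iff.mpr hm)
  rw [← Real.cosh_sub_sinh m]
  field_simp
  ring

/-- **THE STIFF-REGIME FLOOR**: under the hypotheses of `involutive_acceptance_ge_cosh` with `⟨ΔH⟩ > 0`,
`((1 − e^{−⟨ΔH⟩})/(⟨ΔH⟩ + sinh⟨ΔH⟩)) · Z ≤ ∫ min(1, e^{−ΔH}) e^{−H} dμ` — asymptotically `2e^{−⟨ΔH⟩}·Z`,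
the exact two-state rate. [ours] -/
theorem involutive_acceptance_ge_stiff {H : X → ℝ} {Ψ : X → X} (hH : Measurable H)
    (hΨm : Measurable Ψ) (hΨi : Function.Involutive Ψ) (hΨμ : MeasurePreserving Ψ μ μ)
    (hw : Integrable (fun z => Real.exp (-H z)) μ)
    (hΔ : Integrable (fun z => deltaH H Ψ z * Real.exp (-H z)) μ) (hZ : 0 < ∫ z, Real.exp (-H z) ∂μ)
    (hM : 0 < ∫ z, deltaH H Ψ z * Real.exp (-H z) ∂μ) :
    ((1 - Real.exp (-((∫ z, deltaH H Ψ z * Real.exp (-H z) ∂μ) / ∫ z, Real.exp (-H z) ∂μ)))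
        / ((∫ z, deltaH H Ψ z * Real.exp (-H z) ∂μ) / (∫ z, Real.exp (-H z) ∂μ)
            + Real.sinh ((∫ z, deltaH H Ψ z * Real.exp (-H z) ∂μ) / ∫ z, Real.exp (-H z) ∂μ)))
        * ∫ z, Real.exp (-H z) ∂μ
      ≤ ∫ z, min 1 (Real.exp (-deltaH H Ψ z)) * Real.exp (-H z) ∂μ := by
  have hm : 0 < (∫ z, deltaH H Ψ z * Real.exp (-H z) ∂μ) / ∫ z, Real.exp (-H z) ∂μ := div_pos hM hZ
  rw [← one_sub_coshPencil_self hm]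
  exact involutive_acceptance_ge_cosh hH hΨm hΨi hΨμ hw hΔ hZ hm

/-- For `m ≥ 2`, `e^{−m} ≤ (1 − e^{−m})/(m + sinh m)` (equivalently `m ≤ cosh m − 1`; from
`e^{m} ≥ 1 + m + m²/2` twice). [ours] -/
theorem exp_neg_le_stiffFloor {m : ℝ} (hm : 2 ≤ m) :
    Real.exp (-m) ≤ (1 - Real.exp (-m)) / (m + Real.sinh m) := by
  have hm0 : 0 < m := by linarith
  have hc : 0 < m + Real.sinh m := add_pos hm0 (Real.sinh_pos_iff.mpr hm0)
  rw [le_div_iff₀ hc, Real.sinh_eq]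
  set u := Real.exp m with hu
  set v := Real.exp (-m) with hv
  have huv : u * v = 1 := by rw [hu, hv, ← Real.exp_add, add_neg_cancel, Real.exp_zero]
  have hv0 : 0 < v := Real.exp_pos _
  -- `u = e^{m} ≥ (1 + m/2 + m²/8)²` from `e^{m/2} ≥ 1 + m/2 + (m/2)²/2`
  have hp : (1 + m / 2 + m ^ 2 / 8) ^ 2 ≤ u := by
    have h := Real.quadratic_le_exp_of_nonneg (x := m / 2) (by linarith)
    have hq : 0 ≤ 1 + m / 2 + (m / 2) ^ 2 / 2 := by positivity
    have e : u = Real.exp (m / 2) * Real.exp (m / 2) := by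
      rw [hu, ← Real.exp_add]; ring_nf
    calc (1 + m / 2 + m ^ 2 / 8) ^ 2 = (1 + m / 2 + (m / 2) ^ 2 / 2) * (1 + m / 2 + (m / 2) ^ 2 / 2) := by
          ring
      _ ≤ Real.exp (m / 2) * Real.exp (m / 2) := mul_le_mul h h hq (le_trans hq h)
      _ = u := e.symm
  -- `m + 1 ≤ (1 + m/2 + m²/8)²/2` for `m ≥ 2` (at `m = 2 + t`: `16 + 192t + 104t² + 16t³ + t⁴ ≥ 0`)
  have ht : 0 ≤ m - 2 := by linarith
  have hpoly : m + 1 ≤ (1 + m / 2 + m ^ 2 / 8) ^ 2 / 2 := by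
    nlinarith [mul_nonneg ht ht, mul_nonneg (mul_nonneg ht ht) ht,
      mul_nonneg (mul_nonneg ht ht) (mul_nonneg ht ht)]
  -- hence `m + 1 ≤ cosh m = (u + v)/2`, and the claim follows on multiplying by `v = u⁻¹`
  have hcosh : m + 1 ≤ (u + v) / 2 := by linarith [hp, hpoly, hv0.le]
  have h3 := mul_le_mul_of_nonneg_left hcosh hv0.le
  nlinarith [huv, h3, sq_nonneg v]

/-- **`⟨ΔH⟩ ≥ 2 ⇒ ∫ min(1, e^{−ΔH}) e^{−H} ≥ e^{−⟨ΔH⟩} · Z`** — in the stiff regime the equilibrium acceptance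
of ANY volume-preserving reversible proposal is at least `e^{−⟨ΔH⟩}` (twice the Bretagnolle–Huber floor,
half the two-state optimum). [ours] -/
theorem involutive_acceptance_ge_exp_neg_mean {H : X → ℝ} {Ψ : X → X} (hH : Measurable H)
    (hΨm : Measurable Ψ) (hΨi : Function.Involutive Ψ) (hΨμ : MeasurePreserving Ψ μ μ)
    (hw : Integrable (fun z => Real.exp (-H z)) μ)
    (hΔ : Integrable (fun z => deltaH H Ψ z * Real.exp (-H z)) μ) (hZ : 0 < ∫ z, Real.exp (-H z) ∂μ)
    (hM : 2 ≤ (∫ z, deltaH H Ψ z * Real.exp (-H z) ∂μ) / ∫ z, Real.exp (-H z) ∂μ) :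
    Real.exp (-((∫ z, deltaH H Ψ z * Real.exp (-H z) ∂μ) / ∫ z, Real.exp (-H z) ∂μ))
        * ∫ z, Real.exp (-H z) ∂μ
      ≤ ∫ z, min 1 (Real.exp (-deltaH H Ψ z)) * Real.exp (-H z) ∂μ := by
  have hMpos : 0 < ∫ z, deltaH H Ψ z * Real.exp (-H z) ∂μ := by
    by_contra h
    rw [not_lt] at h
    have : (∫ z, deltaH H Ψ z * Real.exp (-H z) ∂μ) / ∫ z, Real.exp (-H z) ∂μ ≤ 0 :=
      div_nonpos_of_nonpos_of_nonneg h hZ.le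
    linarith
  refine le_trans ?_ (involutive_acceptance_ge_stiff hH hΨm hΨi hΨμ hw hΔ hZ hMpos)
  exact mul_le_mul_of_nonneg_right (exp_neg_le_stiffFloor hM) hZ.le

end Stiff

/-! ## §2 The PTBC swap -/

section Swap

open Literature.Probability.MarkovChains

variable {Ω : Type*} [MeasurableSpace Ω] (vol : Measure Ω) [SFinite vol] {S₁ S₂ : Ω → ℝ}

/-- **THE EXTREMAL FLOOR FOR THE SWAP, weighted form**: for measurable actions with `e^{−E}`, `ΔS e^{−E}`
integrable and `Z = ∫ e^{−E} > 0`, for every `a > 0`: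
`(1 − (cosh a − 1 + Z⁻¹∫ ΔS e^{−E})/(a + sinh a))·Z ≤ ∫ min(1, e^{−ΔS}) e^{−E}`. [ours] -/
theorem swap_acceptance_ge_cosh (h₁ : Measurable S₁) (h₂ : Measurable S₂)
    (hint : Integrable (fun z => exp (-pairEnergy S₁ S₂ z)) (vol.prod vol))
    (hΔ : Integrable (fun z => swapDelta S₁ S₂ z * exp (-pairEnergy S₁ S₂ z)) (vol.prod vol))
    (hZ : 0 < ∫ z, exp (-pairEnergy S₁ S₂ z) ∂(vol.prod vol)) {a : ℝ} (ha : 0 < a) :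
    (1 - (Real.cosh a - 1 + (∫ z, swapDelta S₁ S₂ z * exp (-pairEnergy S₁ S₂ z) ∂(vol.prod vol))
        / ∫ z, exp (-pairEnergy S₁ S₂ z) ∂(vol.prod vol)) / (a + Real.sinh a))
        * ∫ z, exp (-pairEnergy S₁ S₂ z) ∂(vol.prod vol)
      ≤ ∫ z, min 1 (exp (-swapDelta S₁ S₂ z)) * exp (-pairEnergy S₁ S₂ z) ∂(vol.prod vol) := by
  have hΔ' : Integrable (fun z => deltaH (pairEnergy S₁ S₂) Prod.swap z * exp (-pairEnergy S₁ S₂ z))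
      (vol.prod vol) := by
    simpa only [deltaH_pairEnergy_swap] using hΔ
  have h := involutive_acceptance_ge_cosh (μ := vol.prod vol) (measurable_pairEnergy h₁ h₂) measurable_swap
    (fun z => Prod.swap_swap z) (measurePreserving_swap_prod_self vol) hint hΔ' hZ ha
  simpa only [deltaH_pairEnergy_swap] using h

/-- **THE EXTREMAL FLOOR FOR THE SWAP under the joint Boltzmann law** `π = e^{−E}(vol⊗vol)/Z`: for every
`a > 0`, `1 − (cosh a − 1 + ∫ ΔS dπ)/(a + sinh a) ≤ ∫ min(1, e^{−ΔS}) dπ`. [ours] -/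
theorem swap_acceptance_ge_cosh_boltzmann (h₁ : Measurable S₁) (h₂ : Measurable S₂)
    (hint : Integrable (fun z => exp (-pairEnergy S₁ S₂ z)) (vol.prod vol))
    (hΔ : Integrable (fun z => swapDelta S₁ S₂ z * exp (-pairEnergy S₁ S₂ z)) (vol.prod vol))
    (hZ : 0 < HMC.partitionFn (vol.prod vol) (pairEnergy S₁ S₂)) {a : ℝ} (ha : 0 < a) :
    1 - (Real.cosh a - 1 + ∫ z, swapDelta S₁ S₂ z ∂(HMC.boltzmann (vol.prod vol) (pairEnergy S₁ S₂)))
        / (a + Real.sinh a)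
      ≤ ∫ z, min 1 (exp (-swapDelta S₁ S₂ z)) ∂(HMC.boltzmann (vol.prod vol) (pairEnergy S₁ S₂)) := by
  have hE := measurable_pairEnergy h₁ h₂
  have hZ' : 0 < ∫ z, exp (-pairEnergy S₁ S₂ z) ∂(vol.prod vol) := hZ
  rw [HMC.integral_boltzmann hE hZ, HMC.integral_boltzmann hE hZ]
  have key := swap_acceptance_ge_cosh vol h₁ h₂ hint hΔ hZ' ha
  simp_rw [mul_comm (exp (-pairEnergy S₁ S₂ _))]
  unfold HMC.partitionFn
  rw [inv_mul_eq_div, inv_mul_eq_div, le_div_iff₀ hZ']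
  exact key

end Swap

/-! ## §3 The linear tempering family: `swapAcc` -/

section Family

open Summit.Ventures.LatticeQCDFlow.Scaling ProbabilityTheory

variable {Ω : Type*} [MeasurableSpace Ω] {μ : Measure Ω} [IsProbabilityMeasure μ] {X : Ω → ℝ}

/-- **THE EXTREMAL FLOOR OF THE EXACT SWAP ACCEPTANCE OF A LINEAR TEMPERING FAMILY**: for `μ` a probability
measure, `X` bounded measurable, replica laws `μ_s, μ_t` (`μ_u = μ.tilted(uX)`), `ψ = cgf X μ`, and every `a > 0`:
`1 − (cosh a − 1 + (t − s)(ψ′(t) − ψ′(s)))/(a + sinh a) ≤ swapAcc X μ s t` — the mean swap log-ratio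
`(t − s)(ψ′(t) − ψ′(s)) = ⟨ΔS⟩` (`SwapLogRatioMoments`) alone bounds the stationary swap acceptance below, sharply.
[ours] -/
theorem swapAcc_ge_coshPencil (hXm : Measurable X) (hXb : ∃ C, ∀ ω, |X ω| ≤ C) (s t : ℝ) {a : ℝ}
    (ha : 0 < a) :
    1 - (Real.cosh a - 1 + (t - s) * (deriv (cgf X μ) t - deriv (cgf X μ) s)) / (a + Real.sinh a)
      ≤ swapAcc X μ s t := by
  obtain ⟨C, hC⟩ := id hXb
  -- the two actions `S₁ = −sX`, `S₂ = −tX` over the reference measure `μ`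
  set S₁ : Ω → ℝ := fun ω => -(s * X ω) with hS₁
  set S₂ : Ω → ℝ := fun ω => -(t * X ω) with hS₂
  have hE : ∀ z : Ω × Ω, exp (-pairEnergy S₁ S₂ z) = exp (s * X z.1 + t * X z.2) := by
    intro z; congr 1; simp only [pairEnergy, hS₁, hS₂]; ring
  have hΔ : ∀ z : Ω × Ω, swapDelta S₁ S₂ z = swapLogRatio X s t z := by
    intro z; simp only [swapDelta, hS₁, hS₂, swapLogRatio_apply]; ring
  have hm₁ : Measurable S₁ := (measurable_const.mul hXm).neg
  have hm₂ : Measurable S₂ := (measurable_const.mul hXm).neg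
  have hint : Integrable (fun z : Ω × Ω => exp (-pairEnergy S₁ S₂ z)) (μ.prod μ) := by
    have h := (integrable_exp_mul_of_bounded (μ := μ) hXm hXb s).mul_prod
      (integrable_exp_mul_of_bounded (μ := μ) hXm hXb t)
    refine h.congr (ae_of_all _ fun z => ?_)
    show exp (s * X z.1) * exp (t * X z.2) = exp (-pairEnergy S₁ S₂ z)
    rw [hE z, exp_add]
  have hΔm : Measurable (swapDelta S₁ S₂) := by
    have e : swapDelta S₁ S₂ = swapLogRatio X s t := funext hΔ
    rw [e]; exact measurable_swapLogRatio hXm s t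
  have hΔI : Integrable (fun z : Ω × Ω => swapDelta S₁ S₂ z * exp (-pairEnergy S₁ S₂ z)) (μ.prod μ) := by
    refine integrable_bdd_mul_weight hΔm (C := |t - s| * (C + C)) (fun z => ?_)
      (measurable_exp.comp (measurable_pairEnergy hm₁ hm₂).neg) (fun z => (exp_pos _).le) hint
    rw [hΔ z, swapLogRatio_apply, abs_mul]
    refine mul_le_mul_of_nonneg_left ?_ (abs_nonneg _)
    calc |X z.2 - X z.1| ≤ |X z.2| + |X z.1| := abs_sub _ _
      _ ≤ C + C := add_le_add (hC _) (hC _)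
  haveI : NeZero (μ.prod μ) := ⟨IsProbabilityMeasure.ne_zero _⟩
  have hZ : 0 < ∫ z, exp (-pairEnergy S₁ S₂ z) ∂(μ.prod μ) := integral_exp_pos hint
  have key := swap_acceptance_ge_cosh μ hm₁ hm₂ hint hΔI hZ ha
  simp only [hE, hΔ] at key
  have hZw : 0 < ∫ z : Ω × Ω, exp (s * X z.1 + t * X z.2) ∂(μ.prod μ) := by
    have e : (fun z : Ω × Ω => exp (-pairEnergy S₁ S₂ z)) = fun z => exp (s * X z.1 + t * X z.2) := funext hE
    rw [← e]; exact hZ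
  unfold swapAcc
  simp_rw [swapIntegrand_eq_min_exp_neg]
  rw [← integral_swapLogRatio hXm hXb s t, integral_prod_tilted_eq_weighted hXm s t,
    integral_prod_tilted_eq_weighted hXm s t, inv_mul_eq_div, inv_mul_eq_div, le_div_iff₀ hZw]
  exact key

end Family

/-! ## §4 Row 2's lattice HMC -/

section Lattice

open Summit.Ventures.LatticeQCDFlow.Scoring

variable {n : ℕ}

/-- **THE EXTREMAL FLOOR FOR ROW 2'S HMC, UNCONDITIONALLY** (coercive action, every step size `δ` and trajectory
length `N`): for every `a > 0`, `(1 − (cosh a − 1 + ⟨ΔH⟩)/(a + sinh a))·Z ≤ ∫ min(1, e^{−ΔH}) e^{−H}`. [ours] -/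
theorem hmc_acceptance_ge_cosh {J : Fin (n + 1) → Fin (n + 1) → ℝ} {lam ε K : ℝ} (hε : 0 < ε)
    (hS : ∀ φ : Fin (n + 1) → ℝ, ε * ∑ w, φ w ^ 2 - K ≤ latticePhi4Action J lam φ)
    (δ : ℝ) (N : ℕ) {a : ℝ} (ha : 0 < a) :
    (1 - (Real.cosh a - 1 + (∫ z, hmcDeltaH J lam δ N z * Real.exp (-phi4HmcEnergy J lam z)
        ∂((volume : Measure (Fin (n + 1) → ℝ)).prod volume))
        / ∫ z, Real.exp (-phi4HmcEnergy J lam z) ∂((volume : Measure (Fin (n + 1) → ℝ)).prod volume))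
        / (a + Real.sinh a))
      * ∫ z, Real.exp (-phi4HmcEnergy J lam z) ∂((volume : Measure (Fin (n + 1) → ℝ)).prod volume)
      ≤ ∫ z, min 1 (Real.exp (-hmcDeltaH J lam δ N z)) * Real.exp (-phi4HmcEnergy J lam z)
          ∂((volume : Measure (Fin (n + 1) → ℝ)).prod volume) :=
  involutive_acceptance_ge_cosh (measurable_phi4HmcEnergy J lam) (measurable_hmcProposal J lam δ N)
    (hmcProposal_involutive J lam δ N) (measurePreserving_hmcProposal J lam δ N)
    (integrable_exp_neg_phi4HmcEnergy hε hS) (integrable_hmcDeltaH_mul_exp_neg hε hS δ N)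
    (integral_exp_pos (integrable_exp_neg_phi4HmcEnergy hε hS)) ha

/-- **Every `λ > 0`, every real `J`, every `δ`, `N`, every `a > 0`.** [ours] -/
theorem hmc_acceptance_ge_cosh_phi4 {lam : ℝ} (hlam : 0 < lam)
    (J : Fin (n + 1) → Fin (n + 1) → ℝ) (δ : ℝ) (N : ℕ) {a : ℝ} (ha : 0 < a) :
    (1 - (Real.cosh a - 1 + (∫ z, hmcDeltaH J lam δ N z * Real.exp (-phi4HmcEnergy J lam z)
        ∂((volume : Measure (Fin (n + 1) → ℝ)).prod volume))
        / ∫ z, Real.exp (-phi4HmcEnergy J lam z) ∂((volume : Measure (Fin (n + 1) → ℝ)).prod volume))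
        / (a + Real.sinh a))
      * ∫ z, Real.exp (-phi4HmcEnergy J lam z) ∂((volume : Measure (Fin (n + 1) → ℝ)).prod volume)
      ≤ ∫ z, min 1 (Real.exp (-hmcDeltaH J lam δ N z)) * Real.exp (-phi4HmcEnergy J lam z)
          ∂((volume : Measure (Fin (n + 1) → ℝ)).prod volume) :=
  hmc_acceptance_ge_cosh one_pos (latticePhi4Action_coercive hlam J) δ N ha

end Lattice

/-! ## §5 The converse reading: a pair acceptance `≤ α` forces `⟨ΔS⟩ ≥ (1−α)·log((2−α)/α)`; replica ceiling -/

section Converse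

open Summit.Ventures.LatticeQCDFlow.Scaling ProbabilityTheory Finset

variable {Ω : Type*} [MeasurableSpace Ω] {μ : Measure Ω} [IsProbabilityMeasure μ] {X : Ω → ℝ}

/-- The pencil member `a = log((2−α)/α)` (so that `tanh(a/2) = 1 − α`): `cosh a − 1 = (1 − α)·sinh a`. [ours] -/
theorem cosh_log_ratio_sub_one {α : ℝ} (hα0 : 0 < α) (hα1 : α < 1) :
    Real.cosh (Real.log ((2 - α) / α)) - 1 = (1 - α) * Real.sinh (Real.log ((2 - α) / α)) := by
  have hu : 0 < (2 - α) / α := div_pos (by linarith) hα0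
  rw [Real.cosh_eq, Real.sinh_eq, Real.exp_neg, Real.exp_log hu]
  have hα : α ≠ 0 := hα0.ne'
  have h2 : (2 - α) ≠ 0 := by intro h; linarith
  field_simp
  ring

/-- **A PAIR THAT ACCEPTS AT MOST `α` HAS MEAN SWAP LOG-RATIO AT LEAST `(1 − α)·log((2 − α)/α)`** (linear tempering
family, model-free; e.g. `α = 1/5`: `⟨ΔS⟩ ≥ (4/5)·log 9`): the pencil read backwards at its member
`tanh(a/2) = 1 − α`. [ours] -/
theorem meanSwap_ge_of_swapAcc_le (hXm : Measurable X) (hXb : ∃ C, ∀ ω, |X ω| ≤ C) {s t α : ℝ}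
    (hα0 : 0 < α) (hα1 : α < 1) (hacc : swapAcc X μ s t ≤ α) :
    (1 - α) * Real.log ((2 - α) / α) ≤ meanSwap X μ s t := by
  set a := Real.log ((2 - α) / α) with ha_def
  have hu1 : 1 < (2 - α) / α := by rw [lt_div_iff₀ hα0]; linarith
  have ha : 0 < a := Real.log_pos hu1
  have hc : 0 < a + Real.sinh a := add_pos ha (Real.sinh_pos_iff.mpr ha)
  have h := swapAcc_ge_coshPencil (μ := μ) hXm hXb s t ha
  rw [meanSwap_eq hXm hXb]
  have h1 : 1 - α ≤ (Real.cosh a - 1 + (t - s) * (deriv (cgf X μ) t - deriv (cgf X μ) s)) / (a + Real.sinh a) := by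
    linarith
  rw [le_div_iff₀ hc] at h1
  have h2 := cosh_log_ratio_sub_one hα0 hα1
  rw [← ha_def] at h2
  nlinarith [h1, h2]

/-- Cauchy–Schwarz for the gaps of a strictly increasing ladder: `K² ≤ (c_K − c_0) · Σ_{j<K} 1/(c_{j+1} − c_j)`. [folklore] -/
theorem sq_card_le_span_mul_sum_inv_gap {c : ℕ → ℝ} (hc : ∀ j, c j < c (j + 1)) (K : ℕ) :
    (K : ℝ) ^ 2 ≤ (c K - c 0) * ∑ j ∈ range K, 1 / (c (j + 1) - c j) := by
  have h := sum_mul_sq_le_sq_mul_sq (range K) (fun j => Real.sqrt (c (j + 1) - c j))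
    (fun j => 1 / Real.sqrt (c (j + 1) - c j))
  have hgap : ∀ j, 0 < c (j + 1) - c j := fun j => sub_pos.2 (hc j)
  have e1 : ∀ j ∈ range K, Real.sqrt (c (j + 1) - c j) * (1 / Real.sqrt (c (j + 1) - c j)) = 1 := by
    intro j _
    rw [mul_one_div, div_self (Real.sqrt_pos.2 (hgap j)).ne']
  have e2 : ∀ j ∈ range K, Real.sqrt (c (j + 1) - c j) ^ 2 = c (j + 1) - c j := fun j _ =>
    Real.sq_sqrt (hgap j).le
  have e3 : ∀ j ∈ range K, (1 / Real.sqrt (c (j + 1) - c j)) ^ 2 = 1 / (c (j + 1) - c j) := by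
    intro j _
    rw [div_pow, one_pow, Real.sq_sqrt (hgap j).le]
  rw [sum_congr rfl e1, sum_congr rfl e2, sum_congr rfl e3, sum_range_sub (fun j => c j) K] at h
  simpa using h

/-- **THE MODEL-FREE REPLICA CEILING OF A FLAT-ACCEPTANCE LADDER**: for a strictly increasing ladder `c_0 < … < c_K`
of the linear tempering family all of whose adjacent pairs accept AT MOST `α ∈ (0,1)` at stationarity,
`(1 − α)·log((2 − α)/α) · K² ≤ (c_K − c_0)·(ψ′(c_K) − ψ′(c_0))` — the number of gaps is at most
`√(span × drop of the mean tempered statistic / m_α)` (sum rule `Σ ⟨ΔS⟩_j/Δc_j = ψ′(c_K) − ψ′(c_0)` + Cauchy–Schwarz).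
[ours] -/
theorem flatLadder_sq_count_le (hXm : Measurable X) (hXb : ∃ C, ∀ ω, |X ω| ≤ C) {c : ℕ → ℝ}
    (hc : ∀ j, c j < c (j + 1)) {α : ℝ} (hα0 : 0 < α) (hα1 : α < 1) (K : ℕ)
    (hacc : ∀ j ∈ range K, swapAcc X μ (c j) (c (j + 1)) ≤ α) :
    (1 - α) * Real.log ((2 - α) / α) * (K : ℝ) ^ 2
      ≤ (c K - c 0) * (deriv (cgf X μ) (c K) - deriv (cgf X μ) (c 0)) := by
  set mα := (1 - α) * Real.log ((2 - α) / α) with hmα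
  have hgap : ∀ j, 0 < c (j + 1) - c j := fun j => sub_pos.2 (hc j)
  have hrule := sum_meanSwap_div_gap (μ := μ) hXm hXb c (fun j => (hc j).ne) K
  -- each term of the sum rule is at least `mα/Δc_j`
  have hterm : ∀ j ∈ range K, mα * (1 / (c (j + 1) - c j)) ≤ meanSwap X μ (c j) (c (j + 1)) / (c (j + 1) - c j) := by
    intro j hj
    rw [mul_one_div]
    exact div_le_div_of_nonneg_right (meanSwap_ge_of_swapAcc_le hXm hXb hα0 hα1 (hacc j hj)) (hgap j).le
  have hsum : mα * ∑ j ∈ range K, 1 / (c (j + 1) - c j) ≤ deriv (cgf X μ) (c K) - deriv (cgf X μ) (c 0) := by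
    rw [← hrule, mul_sum]
    exact sum_le_sum hterm
  have hmono : Monotone c := monotone_nat_of_le_succ fun j => (hc j).le
  have hspan : 0 ≤ c K - c 0 := sub_nonneg.2 (hmono (Nat.zero_le K))
  have hcs := sq_card_le_span_mul_sum_inv_gap hc K
  have hu1 : 1 < (2 - α) / α := by rw [lt_div_iff₀ hα0]; linarith
  have hm0 : 0 ≤ mα := mul_nonneg (by linarith) (Real.log_pos hu1).le
  calc mα * (K : ℝ) ^ 2 ≤ mα * ((c K - c 0) * ∑ j ∈ range K, 1 / (c (j + 1) - c j)) :=
        mul_le_mul_of_nonneg_left hcs hm0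
    _ = (c K - c 0) * (mα * ∑ j ∈ range K, 1 / (c (j + 1) - c j)) := by ring
    _ ≤ (c K - c 0) * (deriv (cgf X μ) (c K) - deriv (cgf X μ) (c 0)) :=
        mul_le_mul_of_nonneg_left hsum hspan

/-- **THE PENCIL IS AFFINE IN THE MEAN ⇒ A UNIFORM LADDER'S AVERAGE ACCEPTANCE IS FLOORED AT THE AVERAGE MEAN**:
for the uniform ladder `c_j = c₀ + jδ` (`δ > 0`, `K ≥ 1` gaps) and every `a > 0`,
`K·(1 − (cosh a − 1 + δ(ψ′(c₀ + Kδ) − ψ′(c₀))/K)/(a + sinh a)) ≤ Σ_{j<K} swapAcc(c_j, c_{j+1})` — by GEN-9's uniform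
sum rule `Σ_j ⟨ΔS⟩_j = δ(ψ′(c_K) − ψ′(c₀))`, the average pair acceptance is at least the pencil (hence the two-state
curve) at the average mean `m̄ = span·drop/K²`: `K ≥ √(span·drop/m_α)` replicas GUARANTEE average acceptance `≥ α`,
model-free (companion of the ceiling `flatLadder_sq_count_le`). [ours] -/
theorem uniformLadder_sum_swapAcc_ge (hXm : Measurable X) (hXb : ∃ C, ∀ ω, |X ω| ≤ C) (c₀ δ : ℝ)
    {K : ℕ} (hK : 0 < K) {a : ℝ} (ha : 0 < a) :
    (K : ℝ) * (1 - (Real.cosh a - 1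
        + δ * (deriv (cgf X μ) (c₀ + K * δ) - deriv (cgf X μ) c₀) / K) / (a + Real.sinh a))
      ≤ ∑ j ∈ range K, swapAcc X μ (c₀ + j * δ) (c₀ + (j + 1) * δ) := by
  have hK' : (0 : ℝ) < K := by exact_mod_cast hK
  have hterm : ∀ j ∈ range K, 1 - (Real.cosh a - 1 + meanSwap X μ (c₀ + j * δ) (c₀ + (j + 1) * δ))
      / (a + Real.sinh a) ≤ swapAcc X μ (c₀ + j * δ) (c₀ + (j + 1) * δ) := by
    intro j _
    rw [meanSwap_eq hXm hXb]
    exact swapAcc_ge_coshPencil hXm hXb _ _ ha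
  have hsum := sum_le_sum hterm
  refine le_trans (le_of_eq ?_) hsum
  rw [sum_sub_distrib, sum_const, card_range, nsmul_eq_mul, mul_one, ← sum_div, sum_add_distrib, sum_const,
    card_range, nsmul_eq_mul, sum_meanSwap_uniform hXm hXb c₀ δ K]
  field_simp

end Converse

end Summit.Ventures.LatticeQCDFlow.Exactness
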